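import Summits.HubbardSuperconductivity.HubbardSuperconductivity.Theorems.AnisotropyChordTransferFibre3L2DeltaCover
import Summits.HubbardSuperconductivity.HubbardSuperconductivity.Theorems.AnisotropyChordTransferFibre3L2CornerBound
import Summits.HubbardSuperconductivity.HubbardSuperconductivity.Theorems.AnisotropyChordTransferFibre3N1RowTCover

/-!
# Route `AnisotropyChord` / H0 rotor rung, LEVEL 2 on the t-BLOCKS: GM₃ from a closed box / closed wedge for `L ≥ 31`, and the
ν-location of the blocks `L ≥ 64`, `L ≥ 96`

p1 g31's cover glue (`…L2CellCover.gm3_of_closed_box`, `…L2DeltaCover.gm3_of_closed_wedge`, `…L2CornerBound.nu_ge_239_of_le` /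
`nu_loc_of_le`) is stated for `128 ≤ L`, but uses it only through `gm3_cellwise` (`31 ≤ L`), `region_sides` (for `0 ≤ a`, `0 < ν`,
true from `L ≥ 3`) and the ν-ceiling `.031`.  For the t-blocks of the range `48 ≤ L < 128` (route-lead ruling R1; block cells
`L2.TCell`, family A at `L ≥ 64` in `…ManifoldA64`, region `…N1RowTCover`) this file restates them at the true thresholds:
* ★★ `gm3_of_closed_box31`, ★★ `gm3_of_closed_wedge31` — verbatim, `31 ≤ L`;
* ★ `nu_ge_239_of_le5`: `ν ≥ 2.39·10⁻⁴` for every ground profile with `0 ≤ Δ ≤ 49/50`, `5 ≤ L ≤ 2^200` (p1's argument: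
  `η_eff ≥ 1/((8/3)H_{L/2} + Δ/(1−Δ))`, `H_n ≤ 1 + log n`);
* ★ `nu_loc64` / ★ `nu_loc96`: the located hypothesis of block theorems — every ground profile of `(L, Δ)` with `64 ≤ L ≤ 2^200`
  (resp. `96 ≤ L`) and `0 < Δ ≤ 49/50` has `ν ∈ [2.39·10⁻⁴, .0359]` (resp. `[2.39·10⁻⁴, .0329]`).
Prover seat `hubbard-h0-rotor-p2` g8; helper for piece A = stmt-HubbardSuperconductivity-23918 of rung 19089
(`--supports`, helper class).  Nothing here proves superconductivity in the Hubbard model; glue/location lemmas for ONE conditional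
reduction (the GM₃ ∀L certificate) on the t-blocks; the rotor TARGET as originally worded stays FALSE (g15 verdict).
Tree imports only; no sorry.
-/

set_option linter.dupNamespace false
set_option autoImplicit false

namespace Summit.HubbardSuperconductivity.HubbardSuperconductivity.Theorems.AnisotropyChord.Transfer.Fibre3

namespace L2

variable (L : ℕ) [NeZero L]

/-- ★★ **GM₃ FROM A CLOSED BOX** (`31 ≤ L`, `0 < Δ < 1`): if every ground profile of `(L, Δ)` lies in a box on which the closure
statement holds, then `GM3Fibre L Δ` (statement of `gm3_of_closed_box`, threshold of `gm3_cellwise`). [folklore] -/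
theorem gm3_of_closed_box31 (hL : 31 ≤ L) {Δ : ℝ} (hΔ0 : 0 < Δ) (hΔ1 : Δ < 1) (n1 n2 a1 a2 : ℝ)
    (hclosed : ∀ lam2 : ℝ, ∀ f : Tor L → ℝ, IsGroundTwoMagnon L Δ lam2 f →
      n1 ≤ lam2 / (2 * Real.pi / L) ^ 2 → lam2 / (2 * Real.pi / L) ^ 2 ≤ n2 → a1 ≤ Δ * f (K1 L) → Δ * f (K1 L) ≤ a2 →
        ∃ c a b : ℝ,
          (0 ≤ mHole L Δ f ∧ facMI L Δ f * etaEff L lam2 * (a + b / (2 + Real.cos (2 * Real.pi / L))) < c) ∧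
          c * Uunit L Δ f ≤ trialGapN1 L Δ f ∧
          lowGForm L Δ f ≤ a * etaEff L lam2 * Uunit L Δ f ∧
          (ip L (resid L Δ f) (resid L Δ f)).re - polePart L Δ f - lowNormPart L Δ f
            ≤ b * etaEff L lam2 * (2 * eps1 L - Tplus L Δ f) * Uunit L Δ f)
    (hloc : ∀ lam2 : ℝ, ∀ f : Tor L → ℝ, IsGroundTwoMagnon L Δ lam2 f →
      n1 ≤ lam2 / (2 * Real.pi / L) ^ 2 ∧ lam2 / (2 * Real.pi / L) ^ 2 ≤ n2 ∧ a1 ≤ Δ * f (K1 L) ∧ Δ * f (K1 L) ≤ a2) :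
    GM3Fibre L Δ := by
  refine gm3_cellwise L hL hΔ0 hΔ1 fun lam2 f hf _ _ => ?_
  obtain ⟨h1, h2, h3, h4⟩ := hloc lam2 f hf
  exact hclosed lam2 f hf h1 h2 h3 h4

/-- ★★ **GM₃ for `0 < Δ ≤ 49/50` from a closed wedge** (`31 ≤ L`): the closure statement on
`{ν ∈ [ν₁, ν₂], 0 ≤ a ≤ 49·(98697/10⁴)·ν}` and the `ν`-location of the profiles of `(L, Δ)` give `GM3Fibre L Δ` (statement of
`gm3_of_closed_wedge`; `0 ≤ a`, `0 < ν` hold from `L ≥ 3`). [folklore] -/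
theorem gm3_of_closed_wedge31 (hL : 31 ≤ L) {Δ : ℝ} (hΔ0 : 0 < Δ) (hΔ98 : Δ ≤ (49 : ℝ) / 50) (n1 n2 : ℝ)
    (hclosed : ∀ lam2 : ℝ, ∀ f : Tor L → ℝ, IsGroundTwoMagnon L Δ lam2 f →
      n1 ≤ lam2 / (2 * Real.pi / L) ^ 2 → lam2 / (2 * Real.pi / L) ^ 2 ≤ n2 → 0 ≤ Δ * f (K1 L) →
        Δ * f (K1 L) ≤ 49 * ((98697 : ℝ) / 10000) * (lam2 / (2 * Real.pi / L) ^ 2) →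
        ∃ c a b : ℝ,
          (0 ≤ mHole L Δ f ∧ facMI L Δ f * etaEff L lam2 * (a + b / (2 + Real.cos (2 * Real.pi / L))) < c) ∧
          c * Uunit L Δ f ≤ trialGapN1 L Δ f ∧
          lowGForm L Δ f ≤ a * etaEff L lam2 * Uunit L Δ f ∧
          (ip L (resid L Δ f) (resid L Δ f)).re - polePart L Δ f - lowNormPart L Δ f
            ≤ b * etaEff L lam2 * (2 * eps1 L - Tplus L Δ f) * Uunit L Δ f)
    (hν : ∀ lam2 : ℝ, ∀ f : Tor L → ℝ, IsGroundTwoMagnon L Δ lam2 f →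
      n1 ≤ lam2 / (2 * Real.pi / L) ^ 2 ∧ lam2 / (2 * Real.pi / L) ^ 2 ≤ n2) :
    GM3Fibre L Δ := by
  have hΔ1 : Δ < 1 := lt_of_le_of_lt hΔ98 (by norm_num)
  refine gm3_cellwise L hL hΔ0 hΔ1 fun lam2 f hf _ _ => ?_
  obtain ⟨h1, h2⟩ := hν lam2 f hf
  have hLpos : (0 : ℝ) < L := by exact_mod_cast (show 0 < L by omega)
  have ha0 : 0 ≤ Δ * f (K1 L) := mul_nonneg hΔ0.le (le_of_lt hf.1.2.2.1)
  have hν0 : 0 < lam2 / (2 * Real.pi / L) ^ 2 := div_pos (lam2_pos L (by omega) hΔ1 hf.1) (by positivity)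
  have hal := a_le_of_delta_le L (by omega) hΔ0.le hΔ1 hf hΔ98 (by norm_num)
  have hπ2 : Real.pi ^ 2 < (98697 : ℝ) / 10000 := by nlinarith [Real.pi_lt_d6, Real.pi_pos]
  have htop : Δ * f (K1 L) ≤ 49 * ((98697 : ℝ) / 10000) * (lam2 / (2 * Real.pi / L) ^ 2) := by
    refine hal.trans ?_
    have : (49 : ℝ) / 50 / (1 - 49 / 50) = 49 := by norm_num
    rw [this]
    nlinarith [hν0]
  exact hclosed lam2 f hf h1 h2 ha0 htop

/-- ★ for `5 ≤ L ≤ 2^200` and `0 ≤ Δ ≤ 49/50`, every ground two-magnon profile has `ν = λ₂/θ² ≥ 2.39·10⁻⁴` (p1's `nu_ge_239_of_le`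
at its true threshold). [folklore] -/
theorem nu_ge_239_of_le5 (hL : 5 ≤ L) (hLmax : L ≤ 2 ^ 200) {Δ lam2 : ℝ} (hΔ0 : 0 ≤ Δ) (hΔ98 : Δ ≤ (49 : ℝ) / 50)
    {f : Tor L → ℝ} (hf : IsGroundTwoMagnon L Δ lam2 f) :
    (239 : ℝ) / 1000000 ≤ lam2 / (2 * Real.pi / L) ^ 2 := by
  have hΔ1 : Δ < 1 := lt_of_le_of_lt hΔ98 (by norm_num)
  have hη := etaEff_ge L hL hΔ0 hΔ1 hf
  obtain ⟨_, _, _, _, _, _, d7⟩ := ManifoldA.manifold_dictionary L hL hΔ0 hΔ1 hf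
  set ν := lam2 / (2 * Real.pi / L) ^ 2 with hν
  -- harmonic bound: `H_{L/2} ≤ 1 + log(L/2) ≤ 1 + 199·log 2 ≤ 139`
  have hH : (harmonic (L / 2) : ℝ) ≤ 139 := by
    have h1 := harmonic_le_one_add_log (L / 2)
    have hL2pos : (0 : ℝ) < ((L / 2 : ℕ) : ℝ) := by
      exact_mod_cast (show 0 < L / 2 by omega)
    have hL2le : ((L / 2 : ℕ) : ℝ) ≤ (2 : ℝ) ^ 199 := by
      have : L / 2 ≤ 2 ^ 199 := by omega
      exact_mod_cast this
    have hlog : Real.log ((L / 2 : ℕ) : ℝ) ≤ 199 * Real.log 2 := by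
      have h2 : Real.log ((2 : ℝ) ^ 199) = 199 * Real.log 2 := by
        rw [Real.log_pow]; norm_num
      rw [← h2]; exact Real.log_le_log hL2pos hL2le
    have hl2 := Real.log_two_lt_d9
    linarith
  -- the `Δ` term
  have hD : Δ / (1 - Δ) ≤ 49 := by
    rw [div_le_iff₀ (by linarith)]; linarith
  have hpos : 0 < 8 / 3 * (harmonic (L / 2) : ℝ) + Δ / (1 - Δ) := by
    have h0 : (0 : ℝ) ≤ Δ / (1 - Δ) := div_nonneg hΔ0 (by linarith)
    have hh : (1 : ℚ) ≤ harmonic (L / 2) := by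
      have h64 : 1 ≤ L / 2 := by omega
      have hm : harmonic 1 ≤ harmonic (L / 2) := by
        unfold harmonic
        apply Finset.sum_le_sum_of_subset_of_nonneg (Finset.range_mono h64)
        intro i _ _; positivity
      have h1 : harmonic 1 = 1 := by
        rw [show (1 : ℕ) = 0 + 1 from rfl, harmonic_succ, harmonic_zero]; norm_num
      linarith
    have hh' : (1 : ℝ) ≤ (harmonic (L / 2) : ℝ) := by exact_mod_cast hh
    linarith
  have hden : 8 / 3 * (harmonic (L / 2) : ℝ) + Δ / (1 - Δ) ≤ 420 := by linarith
  have hη' : 1 / (420 : ℝ) ≤ etaEff L lam2 := (one_div_le_one_div_of_le hpos hden).trans hη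
  have hπ2 : Real.pi ^ 2 < (98697 : ℝ) / 10000 := by nlinarith [Real.pi_lt_d6, Real.pi_pos]
  rw [d7] at hη'
  have hν0 : 0 ≤ ν := by
    have hLpos : (0 : ℝ) < L := by exact_mod_cast (show 0 < L by omega)
    have := lam2_pos L (by omega) hΔ1 hf.1
    rw [hν]; positivity
  nlinarith [hη', hπ2, hν0]

/-- ★ the located hypothesis of the block theorems on `64 ≤ L ≤ 2^200`, `0 < Δ ≤ 49/50`: every ground profile has
`ν ∈ [2.39·10⁻⁴, 0.0359]`. [folklore] -/
theorem nu_loc64 (hL : 64 ≤ L) (hLmax : L ≤ 2 ^ 200) {Δ : ℝ} (hΔ0 : 0 < Δ) (hΔ98 : Δ ≤ (49 : ℝ) / 50) :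
    ∀ lam2 : ℝ, ∀ f : Tor L → ℝ, IsGroundTwoMagnon L Δ lam2 f →
      (239 : ℝ) / 1000000 ≤ lam2 / (2 * Real.pi / L) ^ 2 ∧ lam2 / (2 * Real.pi / L) ^ 2 ≤ (35900 : ℝ) / 1000000 := by
  intro lam2 f hf
  have hΔ1 : Δ < 1 := lt_of_le_of_lt hΔ98 (by norm_num)
  refine ⟨nu_ge_239_of_le5 L (by omega) hLmax hΔ0.le hΔ98 hf, ?_⟩
  have h := (L2.N1.region_sides64 L hL hΔ0.le hΔ1 hf).2.2
  norm_num at h ⊢; linarith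

/-- ★ the located hypothesis of the block theorems on `96 ≤ L ≤ 2^200`, `0 < Δ ≤ 49/50`: every ground profile has
`ν ∈ [2.39·10⁻⁴, 0.0329]`. [folklore] -/
theorem nu_loc96 (hL : 96 ≤ L) (hLmax : L ≤ 2 ^ 200) {Δ : ℝ} (hΔ0 : 0 < Δ) (hΔ98 : Δ ≤ (49 : ℝ) / 50) :
    ∀ lam2 : ℝ, ∀ f : Tor L → ℝ, IsGroundTwoMagnon L Δ lam2 f →
      (239 : ℝ) / 1000000 ≤ lam2 / (2 * Real.pi / L) ^ 2 ∧ lam2 / (2 * Real.pi / L) ^ 2 ≤ (32900 : ℝ) / 1000000 := by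
  intro lam2 f hf
  have hΔ1 : Δ < 1 := lt_of_le_of_lt hΔ98 (by norm_num)
  refine ⟨nu_ge_239_of_le5 L (by omega) hLmax hΔ0.le hΔ98 hf, ?_⟩
  have h := (L2.N1.region_sides96 L hL hΔ0.le hΔ1 hf).2.2
  norm_num at h ⊢; linarith

end L2

end Summit.HubbardSuperconductivity.HubbardSuperconductivity.Theorems.AnisotropyChord.Transfer.Fibre3
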